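import Summits.AtomisticToContinuum.BoseEinsteinCondensation.Theorems.ScaleConvexityFractionCalculus
import Literature.MathematicalPhysics.QuantumManyBody.BoseGasThermodynamicLimitRuelle

/-!
# `ProfileEngine` (route ScaleConvexity, support item) — the loss-telescoping engine on the dyadic coherent-fraction profile

`ProfileEngine := ∀ v ρ, 0 < ρ → NonSteepAt v ρ → PolyScaleAt v ρ → HasGroundStateBEC v ρ` (fully inlined in the route file):
for every `ρ > 0`, NON-STEEPENING of the per-doubling coherence loss (constants `c₀, s, ℓ₀`) and a FRACTION FLOOR `c`
on the polynomial window `ℓ₀ ≤ L_N/2^j ≤ L_N^θ` together force `λ_max(γ_Ψ) ≥ c⋆ N` for near-minimisers, with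
`c⋆ = min c₀ c · c^(κ ⌈4/θ⌉)`, `((2s+1)/(2s+2))^κ ≤ 1/2`.  Ingredients (all kernel-checked, 0 sorry):
* `engine` — the elementary telescoping on a real profile (adaptive pivot at the arg-max of the one-step ratio,
  geometric-sum inequality `r^κ ≤ (1+s) r − s`);
* the fraction calculus of `ScaleConvexityFractionCalculus.lean` (`Φ ≤ 1`, top level `N · Φ_0 ≤ λ_max`);
* level counting (`2^j`-adic levels inside the window, eventually in `N`).
This is the sufficiency half of the node file `HOME/decomp-a2c-lens-6/g7/NodeScaleConvexity.lean` (decomp-a2c lens-6 g7);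
the necessity half (both pieces follow from BEC) and the exactness theorem stay in the node file.
-/

noncomputable section

namespace Summit.AtomisticToContinuum.BoseEinsteinCondensation.Theorems.ScaleConvexityProfileEngine

open Summit.AtomisticToContinuum.BoseEinsteinCondensation.Theorems.ScaleConvexityFractionCalculus
open scoped BigOperators Topology Classical MeasureTheory ComplexConjugate ENNReal NNReal
open Filter Set Function MeasureTheory


/-! ### ENGINE (kernel): the elementary LOSS TELESCOPING on a finite profile `Φ : ℕ → ℝ`

Levels `0 … J` (`0` = the box, `J` = the finest admissible level), window `[ja, J]`.
Hypotheses: `0 ≤ Φ ≤ 1`; window floor `c ≤ Φ j` (`ja ≤ j ≤ J`); non-steepening for `1 ≤ k' < k ≤ J`;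
`κ` with `r_min^κ ≤ 1/2` where `r_min = (2s+1)/(2s+2)`; window long (`r_min^(J−ja) ≤ c`); `J ≤ K (J − ja)`.
Conclusion: `min c₀ c · c^(κK) ≤ Φ 0`. -/

/-- The loss-telescoping engine on a real profile `Φ : ℕ → ℝ` (levels `0 … J`, window `[ja, J]`):
bounds, window floor, non-steepening, `κ` with `r_min^κ ≤ 1/2`, a long window and `J ≤ K (J - ja)` give
`min c₀ c * c ^ (κ * K) ≤ Φ 0`. -/
theorem engine {Φ : ℕ → ℝ} {c₀ c s : ℝ} {ja J κ K : ℕ}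
    (hc₀ : 0 < c₀) (hc : 0 < c) (hs : 0 < s)
    (h0 : ∀ j, j ≤ J → 0 ≤ Φ j) (h1 : ∀ j, j ≤ J → Φ j ≤ 1)
    (hfl : ∀ j, ja ≤ j → j ≤ J → c ≤ Φ j)
    (hns : ∀ k k', 1 ≤ k' → k' < k → k ≤ J →
      c₀ ≤ Φ (k' - 1) ∨ (1 + s) * Φ (k - 1) * Φ k' ≤ s * Φ k * Φ k' + Φ (k' - 1) * Φ k)
    (hκ : ((2 * s + 1) / (2 * s + 2)) ^ κ ≤ 1 / 2)
    (hw : ((2 * s + 1) / (2 * s + 2)) ^ (J - ja) ≤ c) (hJa : ja < J)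
    (hK : J ≤ K * (J - ja)) :
    min c₀ c * c ^ (κ * K) ≤ Φ 0 := by
  -- notation
  set rm : ℝ := (2 * s + 1) / (2 * s + 2) with hrm
  have h2s : (0 : ℝ) < 2 * s + 2 := by linarith
  have hrm_pos : 0 < rm := by rw [hrm]; positivity
  have hrm_lt : rm < 1 := by rw [hrm, div_lt_one h2s]; linarith
  have hrm1 : 1 - rm = 1 / (2 * s + 2) := by rw [hrm]; field_simp; ring
  have hcle1 : c ≤ 1 := (hfl J hJa.le le_rfl).trans (h1 J le_rfl)
  have hΦpos : ∀ j, ja ≤ j → j ≤ J → 0 < Φ j := fun j h h' => lt_of_lt_of_le hc (hfl j h h')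
  set r : ℕ → ℝ := fun j => Φ (j - 1) / Φ j with hr
  -- telescoping product over the window
  have hprod : ∀ n, ja ≤ n → n ≤ J → ∏ j ∈ Finset.Ioc ja n, r j = Φ ja / Φ n := by
    intro n hn
    induction n, hn using Nat.le_induction with
    | base => intro _; simp [div_self (hΦpos ja le_rfl hJa.le).ne']
    | succ n hn ih =>
      intro hnJ
      rw [Finset.prod_Ioc_succ_top hn, ih (Nat.le_of_succ_le hnJ)]
      have hΦn : Φ n ≠ 0 := (hΦpos n hn (Nat.le_of_succ_le hnJ)).ne'
      simp only [hr, Nat.add_sub_cancel]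
      rw [div_mul_div_comm, mul_comm (Φ ja), mul_div_mul_left _ _ hΦn]
  -- the best ratio in the window
  have hne : (Finset.Ioc ja J).Nonempty := ⟨J, Finset.mem_Ioc.2 ⟨hJa, le_rfl⟩⟩
  obtain ⟨js, hjs, hmax⟩ := Finset.exists_max_image (Finset.Ioc ja J) r hne
  obtain ⟨hjs1, hjs2⟩ := Finset.mem_Ioc.1 hjs
  have hΦjs : 0 < Φ js := hΦpos js hjs1.le hjs2
  set rs : ℝ := r js with hrs
  have hr_nonneg : ∀ j ∈ Finset.Ioc ja J, 0 ≤ r j := by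
    intro j hj
    obtain ⟨hj1, hj2⟩ := Finset.mem_Ioc.1 hj
    exact div_nonneg (h0 _ (by omega)) (h0 _ hj2)
  have hrs_nonneg : 0 ≤ rs := hr_nonneg js hjs
  have hrsdef : Φ (js - 1) = rs * Φ js := by
    rw [hrs, hr]; exact (div_mul_cancel₀ _ hΦjs.ne').symm
  have hc_le_pow : c ≤ rs ^ (J - ja) := by
    have h1' : c ≤ Φ ja / Φ J := by
      rw [le_div_iff₀ (hΦpos J hJa.le le_rfl)]
      calc c * Φ J ≤ c * 1 := by gcongr; exact h1 J le_rfl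
        _ = c := mul_one c
        _ ≤ Φ ja := hfl ja le_rfl hJa.le
    calc c ≤ Φ ja / Φ J := h1'
      _ = ∏ j ∈ Finset.Ioc ja J, r j := (hprod J hJa.le le_rfl).symm
      _ ≤ ∏ _j ∈ Finset.Ioc ja J, rs := Finset.prod_le_prod hr_nonneg hmax
      _ = rs ^ (J - ja) := by rw [Finset.prod_const, Nat.card_Ioc]
  -- rs ≥ r_min (the window is long)
  have hrs_ge : rm ≤ rs := by
    by_contra hlt
    push Not at hlt
    have hm0 : J - ja ≠ 0 := Nat.sub_ne_zero_of_lt hJa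
    have : rs ^ (J - ja) < rm ^ (J - ja) := pow_lt_pow_left₀ hlt hrs_nonneg hm0
    linarith
  -- key inequality: r^κ ≤ (1+s) r − s on [r_min, 1]
  have key : ∀ x : ℝ, rm ≤ x → x ≤ 1 → x ^ κ ≤ (1 + s) * x - s := by
    intro x hx1 hx2
    have hgeom_rm : 1 + s ≤ ∑ i ∈ Finset.range κ, rm ^ i := by
      have hmul : (1 - rm) * ∑ i ∈ Finset.range κ, rm ^ i = 1 - rm ^ κ := mul_neg_geom_sum rm κ
      have h1rm : 0 < 1 - rm := by linarith
      have : (1 - rm) * (1 + s) ≤ (1 - rm) * ∑ i ∈ Finset.range κ, rm ^ i := by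
        rw [hmul, hrm1]
        have : 1 / (2 * s + 2) * (1 + s) = 1 / 2 := by field_simp; ring
        rw [this]; linarith
      exact le_of_mul_le_mul_left this h1rm
    have hgeom : 1 + s ≤ ∑ i ∈ Finset.range κ, x ^ i :=
      hgeom_rm.trans (Finset.sum_le_sum fun i _ => pow_le_pow_left₀ hrm_pos.le hx1 i)
    have hmul : (1 - x) * ∑ i ∈ Finset.range κ, x ^ i = 1 - x ^ κ := mul_neg_geom_sum x κ
    have h1x : 0 ≤ 1 - x := by linarith
    have := mul_le_mul_of_nonneg_left hgeom h1x
    rw [hmul] at this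
    linarith
  -- λ and μ
  set lam : ℝ := (1 + s) * rs - s with hlam
  set μ : ℝ := min lam rs with hμ
  have hlam_pos : 0 < lam := by
    have : (1 + s) * rm - s = 1 / 2 := by rw [hrm]; field_simp; ring
    have : (1 + s) * rm ≤ (1 + s) * rs := by gcongr
    rw [hlam]; linarith
  have hμ_pos : 0 < μ := lt_min hlam_pos (lt_of_lt_of_le hrm_pos hrs_ge)
  -- one step down from any level k' ≤ js without floor
  have hstep : ∀ k', 1 ≤ k' → k' ≤ js → ¬ (c₀ ≤ Φ (k' - 1)) → μ * Φ k' ≤ Φ (k' - 1) := by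
    intro k' hk1 hk2 hnf
    have hΦk' : 0 ≤ Φ k' := h0 k' (hk2.trans hjs2)
    rcases lt_or_eq_of_le hk2 with hlt | heq
    · rcases hns js k' hk1 hlt hjs2 with hf | hineq
      · exact absurd hf hnf
      · rw [hrsdef] at hineq
        have hlamstep : lam * Φ k' ≤ Φ (k' - 1) := by
          -- (1+s)·rs·Φjs·Φk' ≤ s·Φjs·Φk' + Φ(k'-1)·Φjs ; cancel Φjs > 0
          have h' : ((1 + s) * rs - s) * Φ k' * Φ js ≤ Φ (k' - 1) * Φ js := by nlinarith
          exact le_of_mul_le_mul_right h' hΦjs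
        calc μ * Φ k' ≤ lam * Φ k' := mul_le_mul_of_nonneg_right (min_le_left _ _) hΦk'
          _ ≤ Φ (k' - 1) := hlamstep
    · subst heq
      calc μ * Φ k' ≤ rs * Φ k' := mul_le_mul_of_nonneg_right (min_le_right _ _) hΦk'
        _ = Φ (k' - 1) := hrsdef.symm
  -- the coarsest floor level below js (or js itself)
  have hM : ∃ m, m ≤ js ∧ min c₀ c ≤ Φ m ∧ ∀ k', 1 ≤ k' → k' ≤ m → μ * Φ k' ≤ Φ (k' - 1) := by
    by_cases hS : ∃ k', 1 ≤ k' ∧ k' ≤ js ∧ c₀ ≤ Φ (k' - 1)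
    · let kmin := Nat.find hS
      obtain ⟨hk1, hk2, hk3⟩ := Nat.find_spec hS
      refine ⟨kmin - 1, by omega, (min_le_left _ _).trans hk3, fun k' h1' h2' => hstep k' h1' (by omega) ?_⟩
      intro hf
      have hlt : k' < kmin := by omega
      exact Nat.find_min hS hlt ⟨h1', by omega, hf⟩
    · push Not at hS
      refine ⟨js, le_rfl, (min_le_right _ _).trans (hfl js hjs1.le hjs2), fun k' h1' h2' => hstep k' h1' h2' ?_⟩
      exact not_le.2 (hS k' h1' h2')
  obtain ⟨m, hmjs, hΦm, hdown⟩ := hM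
  -- telescope from m down to 0
  have htel : ∀ i, i ≤ m → μ ^ i * Φ m ≤ Φ (m - i) := by
    intro i hi
    induction i with
    | zero => simp
    | succ i ih =>
      have ih' := ih (Nat.le_of_succ_le hi)
      have hk : 1 ≤ m - i := by omega
      have h := hdown (m - i) hk (Nat.sub_le _ _)
      rw [show m - i - 1 = m - (i + 1) by omega] at h
      calc μ ^ (i + 1) * Φ m = μ * (μ ^ i * Φ m) := by ring
        _ ≤ μ * Φ (m - i) := mul_le_mul_of_nonneg_left ih' hμ_pos.le
        _ ≤ Φ (m - (i + 1)) := h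
  have htel0 : μ ^ m * Φ m ≤ Φ 0 := by simpa using htel m le_rfl
  -- μ^m ≥ c^(κK)
  have hμm : c ^ (κ * K) ≤ μ ^ m := by
    rcases le_or_gt rs 1 with hrs1 | hrs1
    · have hlam_le : lam ≤ rs := by rw [hlam]; nlinarith
      have hμeq : μ = lam := min_eq_left hlam_le
      have hkey : rs ^ κ ≤ lam := key rs hrs_ge hrs1
      have hmK : κ * m ≤ κ * K * (J - ja) := by
        have : m ≤ K * (J - ja) := (hmjs.trans hjs2).trans hK
        calc κ * m ≤ κ * (K * (J - ja)) := Nat.mul_le_mul_left κ this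
          _ = κ * K * (J - ja) := by ring
      calc c ^ (κ * K) ≤ (rs ^ (J - ja)) ^ (κ * K) := pow_le_pow_left₀ hc.le hc_le_pow _
        _ = rs ^ (κ * K * (J - ja)) := by rw [← pow_mul]; ring_nf
        _ ≤ rs ^ (κ * m) := pow_le_pow_of_le_one hrs_nonneg hrs1 hmK
        _ = (rs ^ κ) ^ m := pow_mul rs κ m
        _ ≤ lam ^ m := pow_le_pow_left₀ (pow_nonneg hrs_nonneg κ) hkey m
        _ = μ ^ m := by rw [hμeq]
    · have hlam_gt : rs < lam := by rw [hlam]; nlinarith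
      have hμeq : μ = rs := min_eq_right hlam_gt.le
      calc c ^ (κ * K) ≤ 1 := pow_le_one₀ hc.le hcle1
        _ ≤ μ ^ m := by rw [hμeq]; exact one_le_pow₀ hrs1.le
  -- conclude
  have hmin0 : 0 ≤ min c₀ c := le_min hc₀.le hc.le
  calc min c₀ c * c ^ (κ * K) ≤ Φ m * μ ^ m := mul_le_mul hΦm hμm (pow_nonneg hc.le _) ((hmin0).trans hΦm)
    _ = μ ^ m * Φ m := mul_comm _ _
    _ ≤ Φ 0 := htel0


/-! ### KERNEL: level counting and the sufficiency `P₁ ∧ P₂ ⇒ HasGroundStateBEC` per density -/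

section Sufficiency
open Literature.MathematicalPhysics.QuantumManyBody.BoseGas

/-- LEVEL COUNTING (pure real arithmetic). `J` = finest level (`2^J ≤ L/ℓ < 2^(J+1)`), `ja` = coarsest level of
the polynomial window (`L/2^ja ≤ L^θ`, minimal). If `L ≥ 1`, `4ℓ·2^m₁ ≤ L^θ`, `(4ℓ)^K/ℓ ≤ L³` and `4 ≤ θK`, then
the window has at least `m₁` levels and the total depth is at most `K` windows. -/
theorem level_count {L ℓ θ : ℝ} {m₁ K J ja : ℕ} (hℓ : 0 < ℓ) (hθ : 0 < θ) (hθ1 : θ < 1)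
    (hKθ : 4 ≤ θ * K) (hL1 : 1 ≤ L) (hA : 4 * ℓ * 2 ^ m₁ ≤ L ^ θ) (hB : (4 * ℓ) ^ K / ℓ ≤ L ^ 3)
    (hJ1 : (2 : ℝ) ^ J ≤ L / ℓ) (hJ2 : L / ℓ < (2 : ℝ) ^ (J + 1)) (hja : L / 2 ^ ja ≤ L ^ θ)
    (hja_min : ∀ j, j < ja → L ^ θ < L / 2 ^ j) :
    ja + m₁ ≤ J ∧ J ≤ K * (J - ja) := by
  have hLpos : 0 < L := lt_of_lt_of_le one_pos hL1
  set u : ℝ := L ^ θ with hu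
  set w : ℝ := L ^ (1 - θ) with hw
  have hupos : 0 < u := Real.rpow_pos_of_pos hLpos θ
  have hwpos : 0 < w := Real.rpow_pos_of_pos hLpos (1 - θ)
  have hw1 : 1 ≤ w := Real.one_le_rpow hL1 (by linarith)
  have huw : u * w = L := by
    rw [hu, hw, ← Real.rpow_add hLpos]; norm_num
  -- 2^J ≥ L/(2ℓ)
  have h2J : L / (2 * ℓ) ≤ (2 : ℝ) ^ J := by
    rw [pow_succ] at hJ2
    rw [div_le_iff₀ (by positivity)]
    rw [div_lt_iff₀ hℓ] at hJ2
    linarith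
  -- 2^ja ≤ 2 w
  have hja2 : (2 : ℝ) ^ ja ≤ 2 * w := by
    cases ja with
    | zero => simp; linarith
    | succ j =>
      have h := hja_min j (Nat.lt_succ_self j)
      -- u < L / 2^j ⇒ 2^j < L/u = w
      have h2j : (0 : ℝ) < 2 ^ j := by positivity
      rw [lt_div_iff₀ h2j] at h
      have : (2 : ℝ) ^ j < w := by
        by_contra hc
        push Not at hc
        have : u * w ≤ u * 2 ^ j := by gcongr
        linarith
      rw [pow_succ]; linarith
  -- (a) ja + m₁ ≤ J
  have ha : (2 : ℝ) ^ (ja + m₁) ≤ 2 ^ J := by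
    rw [pow_add]
    calc (2 : ℝ) ^ ja * 2 ^ m₁ ≤ 2 * w * 2 ^ m₁ := by gcongr
      _ = (4 * ℓ * 2 ^ m₁) * w / (2 * ℓ) := by field_simp; ring
      _ ≤ u * w / (2 * ℓ) := by gcongr
      _ = L / (2 * ℓ) := by rw [huw]
      _ ≤ 2 ^ J := h2J
  have ha' : ja + m₁ ≤ J := (pow_le_pow_iff_right₀ (by norm_num : (1 : ℝ) < 2)).1 ha
  refine ⟨ha', ?_⟩
  -- (b) J ≤ K (J − ja)
  have hjaJ : ja ≤ J := le_trans (Nat.le_add_right _ _) ha'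
  have hbase : u / (4 * ℓ) ≤ (2 : ℝ) ^ (J - ja) := by
    rw [pow_sub₀ _ (by norm_num) hjaJ]
    have : u / (4 * ℓ) = (L / (2 * ℓ)) / (2 * w) := by
      rw [← huw]; field_simp; ring
    rw [this]
    exact div_le_div₀ (by positivity) h2J (by positivity) hja2
  have hupow : L ^ 4 ≤ u ^ K := by
    rw [hu, ← Real.rpow_natCast (L ^ θ), ← Real.rpow_mul hLpos.le]
    calc L ^ 4 = L ^ ((4 : ℕ) : ℝ) := (Real.rpow_natCast L 4).symm
      _ ≤ L ^ (θ * K) := Real.rpow_le_rpow_of_exponent_le hL1 (by push_cast; linarith)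
  have hb : (2 : ℝ) ^ J ≤ 2 ^ (K * (J - ja)) := by
    rw [mul_comm K, pow_mul]
    calc (2 : ℝ) ^ J ≤ L / ℓ := hJ1
      _ ≤ L ^ 4 / (4 * ℓ) ^ K := by
          rw [div_le_div_iff₀ hℓ (by positivity)]
          -- L (4ℓ)^K ≤ L^4 ℓ  ⟸  (4ℓ)^K/ℓ ≤ L³
          rw [div_le_iff₀ hℓ] at hB
          nlinarith
      _ ≤ u ^ K / (4 * ℓ) ^ K := by gcongr
      _ = (u / (4 * ℓ)) ^ K := by rw [div_pow]
      _ ≤ ((2 : ℝ) ^ (J - ja)) ^ K := pow_le_pow_left₀ (by positivity) hbase K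
  exact (pow_le_pow_iff_right₀ (by norm_num : (1 : ℝ) < 2)).1 hb

/-- **SUFFICIENCY per density (kernel)**: non-steepening ∧ polynomial-scale condensation ⇒ `HasGroundStateBEC`. -/
theorem hasGroundStateBEC_of_profiles {v : ℝ → ENNReal} {ρ : ℝ} (hρ : 0 < ρ) (h₁ : NonSteepAt v ρ)
    (h₂ : PolyScaleAt v ρ) : HasGroundStateBEC v ρ := by
  obtain ⟨c₀, hc₀, s, hs, ℓ₁, hℓ₁, hE₁⟩ := h₁
  obtain ⟨θ, hθ, hθ1, c, hc, ℓ₂, hℓ₂, hE₂⟩ := h₂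
  -- constants
  set ℓ : ℝ := max ℓ₁ ℓ₂ with hℓdef
  have hℓ : 0 < ℓ := lt_max_of_lt_left hℓ₁
  set rm : ℝ := (2 * s + 1) / (2 * s + 2) with hrm
  have hrm_pos : 0 < rm := by rw [hrm]; positivity
  have hrm_lt : rm < 1 := by rw [hrm, div_lt_one (by linarith)]; linarith
  obtain ⟨κ, hκ⟩ := exists_pow_lt_of_lt_one (by norm_num : (0 : ℝ) < 1 / 2) hrm_lt
  obtain ⟨m₀, hm₀⟩ := exists_pow_lt_of_lt_one hc hrm_lt
  set m₁ : ℕ := max m₀ 1 with hm₁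
  set K : ℕ := ⌈4 / θ⌉₊ with hKdef
  have hKθ : 4 ≤ θ * K := by
    have : 4 / θ ≤ K := Nat.le_ceil _
    rwa [div_le_iff₀' hθ] at this
  set cstar : ℝ := min c₀ c * c ^ (κ * K) with hcstar
  have hcstar_pos : 0 < cstar := mul_pos (lt_min hc₀ hc) (pow_pos hc _)
  refine ⟨cstar, hcstar_pos, ?_⟩
  -- eventual conditions on N
  have hC : ∀ᶠ N : ℕ in atTop, max 1 ℓ ≤ sideLength ρ N := (tendsto_sideLength_atTop hρ).eventually_ge_atTop _
  have hA : ∀ᶠ N : ℕ in atTop, 4 * ℓ * 2 ^ m₁ ≤ sideLength ρ N ^ θ :=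
    ((tendsto_rpow_atTop hθ).comp (tendsto_sideLength_atTop hρ)).eventually_ge_atTop _
  have hB : ∀ᶠ N : ℕ in atTop, (4 * ℓ) ^ K / ℓ ≤ (N : ℝ) / ρ :=
    (tendsto_natCast_atTop_atTop.atTop_div_const hρ).eventually_ge_atTop _
  have hN1 : ∀ᶠ N : ℕ in atTop, 1 ≤ N := eventually_ge_atTop 1
  filter_upwards [hE₁, hE₂, hC, hA, hB, hN1] with N hN₁ hN₂ hCN hAN hBN h1N
  obtain ⟨n, rfl⟩ : ∃ n, N = n + 1 := Nat.exists_eq_succ_of_ne_zero (by omega)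
  obtain ⟨δ₁, hδ₁, H₁⟩ := hN₁
  obtain ⟨δ₂, hδ₂, H₂⟩ := hN₂
  set L : ℝ := sideLength ρ (n + 1) with hLdef
  have hL1 : 1 ≤ L := le_trans (le_max_left _ _) hCN
  have hℓL : ℓ ≤ L := le_trans (le_max_right _ _) hCN
  have hLpos : 0 < L := lt_of_lt_of_le one_pos hL1
  have hB' : (4 * ℓ) ^ K / ℓ ≤ L ^ 3 := by rw [hLdef, sideLength_pow_three hρ]; exact hBN
  -- the levels
  obtain ⟨J, hJ1, hJ2⟩ := exists_nat_pow_near ((one_le_div hℓ).2 hℓL) (one_lt_two (α := ℝ))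
  have hex : ∃ j : ℕ, L / 2 ^ j ≤ L ^ θ := by
    obtain ⟨j, hj⟩ := pow_unbounded_of_one_lt L (one_lt_two (α := ℝ))
    refine ⟨j, ?_⟩
    calc L / 2 ^ j ≤ 1 := (div_le_one (by positivity)).2 hj.le
      _ ≤ L ^ θ := Real.one_le_rpow hL1 hθ.le
  set ja : ℕ := Nat.find hex with hjadef
  have hja : L / 2 ^ ja ≤ L ^ θ := Nat.find_spec hex
  have hja_min : ∀ j, j < ja → L ^ θ < L / 2 ^ j := fun j hj => not_le.1 (Nat.find_min hex hj)
  obtain ⟨hcount1, hcount2⟩ := level_count hℓ hθ hθ1 hKθ hL1 hAN hB' hJ1 hJ2 hja hja_min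
  have hJa : ja < J := by omega
  have hw : rm ^ (J - ja) ≤ c :=
    le_trans (pow_le_pow_of_le_one hrm_pos.le hrm_lt.le (by omega : m₀ ≤ J - ja)) hm₀.le
  -- scales of the levels
  have hside : ∀ j, j ≤ J → ℓ ≤ L / 2 ^ j := by
    intro j hj
    rw [le_div_iff₀ (by positivity)]
    rw [le_div_iff₀ hℓ] at hJ1
    calc ℓ * 2 ^ j ≤ ℓ * 2 ^ J := by gcongr; norm_num
      _ = 2 ^ J * ℓ := mul_comm _ _
      _ ≤ L := hJ1
  have hwin : ∀ j, ja ≤ j → L / 2 ^ j ≤ L ^ θ := by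
    intro j hj
    calc L / 2 ^ j ≤ L / 2 ^ ja := by gcongr; norm_num
      _ ≤ L ^ θ := hja
  -- the claim at this N
  refine le_condensateNumber v (lt_min hδ₁ hδ₂) fun Ψ hΨ => ?_
  have hΨ₁ : energy v Ψ ≤ groundStateEnergy v (n + 1) L + δ₁ :=
    hΨ.trans (by gcongr; exact min_le_left _ _)
  have hΨ₂ : energy v Ψ ≤ groundStateEnergy v (n + 1) L + δ₂ :=
    hΨ.trans (by gcongr; exact min_le_right _ _)
  have hΨm : Measurable Ψ.ψ := Ψ.contDiff.continuous.measurable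
  set F : ℕ → ENNReal := fun j => frac (n + 1) L j Ψ.ψ with hF
  have hFtop : ∀ j, F j ≠ ⊤ := fun j => frac_ne_top L j hΨm
  set Φ : ℕ → ℝ := fun j => (F j).toReal with hΦ
  have G₁ := H₁ Ψ hΨ₁ F (fun j => rfl)
  have G₂ := H₂ Ψ hΨ₂ F (fun j => rfl)
  -- run the engine
  have hmain : cstar ≤ Φ 0 := by
    refine engine (Φ := Φ) hc₀ hc hs (fun j _ => ENNReal.toReal_nonneg)
      (fun j _ => ?_) (fun j hj1 hj2 => ?_) (fun k k' hk1 hk2 hk3 => ?_) hκ.le hw hJa hcount2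
    · -- Φ ≤ 1
      have := ENNReal.toReal_mono ENNReal.one_ne_top (frac_le_one L j hΨm)
      simpa [hΦ, hF] using this
    · -- window floor
      have h := G₂ j ((le_max_right _ _).trans (hside j hj2)) (hwin j hj1)
      exact (ENNReal.ofReal_le_iff_le_toReal (hFtop j)).1 h
    · -- non-steepening
      rcases G₁ k k' hk1 hk2 ((le_max_left _ _).trans (hside k hk3)) with hf | hineq
      · exact Or.inl ((ENNReal.ofReal_le_iff_le_toReal (hFtop _)).1 hf)
      · right
        have hfin : ENNReal.ofReal s * F k * F k' + F (k' - 1) * F k ≠ ⊤ :=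
          ENNReal.add_ne_top.2 ⟨ENNReal.mul_ne_top (ENNReal.mul_ne_top ENNReal.ofReal_ne_top (hFtop _)) (hFtop _),
            ENNReal.mul_ne_top (hFtop _) (hFtop _)⟩
        have h := ENNReal.toReal_mono hfin hineq
        rw [ENNReal.toReal_add (ENNReal.mul_ne_top (ENNReal.mul_ne_top ENNReal.ofReal_ne_top (hFtop _)) (hFtop _))
          (ENNReal.mul_ne_top (hFtop _) (hFtop _))] at h
        simp only [ENNReal.toReal_mul, ENNReal.toReal_add ENNReal.one_ne_top ENNReal.ofReal_ne_top,
          ENNReal.toReal_one, ENNReal.toReal_ofReal hs.le] at h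
        simpa [hΦ] using h
  -- back to λ_max
  have h0 : ENNReal.ofReal cstar ≤ frac (n + 1) L 0 Ψ.ψ :=
    (ENNReal.ofReal_le_iff_le_toReal (hFtop 0)).2 hmain
  have := mul_le_maxOccupation_of_le_frac_zero Ψ h0
  have hcast : ENNReal.ofReal (((n + 1 : ℕ) : ℝ)) = ((n + 1 : ℕ) : ℝ≥0∞) := ENNReal.ofReal_natCast _
  rw [ENNReal.ofReal_mul hcstar_pos.le, hcast]
  push_cast
  exact this

end Sufficiency

/-! ### The route item, concluded BY NAME -/

/-- **`ProfileEngine`** (support item of route ScaleConvexity): the inlined statement unfolds definitionally to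
`∀ v ρ, 0 < ρ → NonSteepAt v ρ → PolyScaleAt v ρ → HasGroundStateBEC v ρ`. [folklore bookkeeping; LSSY2005 §1.2 for the objects] -/
theorem profileEngine_holds :
    Summit.AtomisticToContinuum.BoseEinsteinCondensation.Theses.ScaleConvexity.ProfileEngine := by
  intro v ρ hρ h₁ h₂
  exact hasGroundStateBEC_of_profiles (v := v) (ρ := ρ) hρ h₁ h₂

end Summit.AtomisticToContinuum.BoseEinsteinCondensation.Theorems.ScaleConvexityProfileEngine
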